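import Mathlib
import HarnessLib
import Literature.Probability.LatticeModels.TorusFourierMomentsFromDifferences
import Literature.MathematicalPhysics.QuantumLattice.HubbardUVBandPiecesGeometric
import Literature.MathematicalPhysics.QuantumLattice.HubbardUVSymbolCTDifferences
import Summits.HubbardSuperconductivity.HubbardSuperconductivity.Theorems.KLProgrammeKLRegimeEngineScaleZeroE4Bands

/-!
# K3 gen-8-FLOW (stmt 20437 `KLRegimeEngineV17F2`, stub (C), door (B) = S6 door (2)): the (S)-half SUPPLIER — position moments of the
# frame-shift SYMBOL difference `k⃗ ↦ Ψ_{K₁}((ω_i,k⃗),σ) − Ψ_{K₀}((ω_i,k⃗),σ)` from the jets of the two frame bands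

Cell gate-hubbard-kl, seat p2 g11.  The moment door `…EngineFrameShiftMomentResponse.moment_selfEnergy_frameShift_sub_le` (p536707) is conditional on the
moments `D_w = Σ_x w(x)‖𝔉⁻¹[k⃗ ↦ (s₁ − s₀)((ω_i,k⃗),σ)](x)‖` of the symbol difference at the reading frequency (`s_j = uvSymbolCT … K_j Λ`).  This file supplies
them for the engine's weight `w = (1+|x̃₀|+|x̃₁|)^r` from the JETS OF THE FRAME BANDS, by the chain
`uvSymbolCT((i,k⃗),σ) = uvSymbol₂ (βL²) Λ (ω_i, e_K(p_k⃗))` (`uvSymbolCT_eq_uvSymbolFn`, `nambuXiCT_eq_frameLevel`) →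
`Literature/…/HubbardUVBandPiecesGeometric.incrPiece_value_le_of_geometric` (sampled mixed differences of the band increment `e_{K₀} → e_{K₁}` at EVERY order
with geometric constants `A = 2βL²B(2/m)²`, `ρ = 6/m`, `m = max(|ω_i|,Λ/2)`, ONE jet of `e_{K₁} − e_{K₀}` per term) →
`Literature/…/TorusFourierMomentsFromDifferences.sum_momentWeight_mul_norm_torusFourierInv_le` (moments of order `r` from the sup laws of total order `≤ r+2`,
`L`-uniform normalisation `(L/4)^{a+b}(2π/L)^{a+b} = (π/2)^{a+b}`):

* `fwdDiff_iter₂_sub_apply` — mixed lattice differences are linear (Mathlib `fwdDiffₗ`);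
* `uvSymbolCT_eq_uvSymbol₂_frameLevel` — the lattice symbol is the plane symbol on the fibre `{ω_i}` at the band value `e_K(p_k⃗)`;
* **`frameShift_symbol_moment_le`** — for frames `K₀, K₁` whose interpolated bands `e_{K₀} + s(e_{K₁} − e_{K₀})` have jets `‖Dⁱ‖ ≤ d·(6/m)^{i−1}`
  (`1 ≤ i ≤ r+2`, `s ∈ [0,1]`) and whose difference has jets `‖Dⁱ(e_{K₁} − e_{K₀})‖ ≤ Wᵢ` (`i ≤ r+2`), and `𝒥` with
  `(π/2)^k·Σ_{j≤k} C(k,j)·(j!·(A·j!)·(max(d,1)·6/m)ʲ)·W_{k−j} ≤ 𝒥` for `k ≤ r+2`: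
  `Σ_x (1+|x̃₀|+|x̃₁|)^r·‖𝔉⁻¹[k⃗ ↦ Ψ_{K₁} − Ψ_{K₀}](x)‖ ≤ 21·3^r·𝒥` — LINEAR in the frame-difference jets `W` (for `K₁ = K_{n+1}`, `K₀ = K_n`:
  `e_{K₁} − e_{K₀} = −klFlowPiece n`, `W_i = Gfr_i·uPow i U·4^{(i−2)n}` by (I-F jets) for `i ≤ 4`).

Proofs only; the band-jet tables `d`, `W`, `𝒥` and the cutoff bound `B` are hypotheses; nothing about their sizes is asserted; nothing asserts
superconductivity.  References: BGM 2006 §2.1 (2.36aa), Lemma 2.2, §3 (3.2)–(3.8) [cite: BenfattoGiulianiMastropietro2006].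
-/

noncomputable section

namespace Summit.HubbardSuperconductivity.HubbardSuperconductivity.Theorems.EngineV8

set_option linter.dupNamespace false -- summit = problem name (single-conjunct summit), D-0017

open Finset Literature.MathematicalPhysics.QuantumLattice Literature.Probability.LatticeModels Set
open Summit.HubbardSuperconductivity.HubbardSuperconductivity.Theorems.KLRegimeSplit
open Summit.HubbardSuperconductivity.HubbardSuperconductivity.Theorems.DispersionFlow
open Summit.HubbardSuperconductivity.HubbardSuperconductivity.Theorems.ScaleZeroDecay
open scoped Nat

variable {L M : ℕ} [NeZero L]

/-! ## §1 Bookkeeping -/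

omit [NeZero L] in
/-- **Iterated lattice differences are linear**: `Δ_v^n (F − G) = Δ_v^n F − Δ_v^n G`. -/
theorem fwdDiff_iter_sub (v : TorusSite 2 L) (n : ℕ) (F G : TorusSite 2 L → ℂ) :
    (_root_.fwdDiff v)^[n] (fun y => F y - G y) = fun y => (_root_.fwdDiff v)^[n] F y - (_root_.fwdDiff v)^[n] G y := by
  induction n generalizing F G with
  | zero => rfl
  | succ n ih =>
    rw [Function.iterate_succ_apply, Function.iterate_succ_apply, Function.iterate_succ_apply]
    have h1 : _root_.fwdDiff v (fun y => F y - G y) = fun y => _root_.fwdDiff v F y - _root_.fwdDiff v G y := by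
      funext z; simp only [_root_.fwdDiff]; ring
    rw [h1, ih]

omit [NeZero L] in
/-- **Mixed lattice differences are linear**: `Δ_u^a Δ_v^b (F − G)(k) = Δ_u^aΔ_v^b F(k) − Δ_u^aΔ_v^b G(k)`. -/
theorem fwdDiff_iter₂_sub_apply (u v : TorusSite 2 L) (a b : ℕ) (F G : TorusSite 2 L → ℂ) (k : TorusSite 2 L) :
    (_root_.fwdDiff u)^[a] ((_root_.fwdDiff v)^[b] (fun y => F y - G y)) k =
      (_root_.fwdDiff u)^[a] ((_root_.fwdDiff v)^[b] F) k - (_root_.fwdDiff u)^[a] ((_root_.fwdDiff v)^[b] G) k := by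
  rw [fwdDiff_iter_sub v b, fwdDiff_iter_sub u a]

/-- **The lattice UV symbol is the plane symbol on the frequency fibre at the frame band value**:
`uvSymbolCT L M β μ K Λ ((i,k⃗),σ) = uvSymbol₂ (βL²) Λ (ω_i, e_K(p_k⃗))` (`0 < β`). -/
theorem uvSymbolCT_eq_uvSymbol₂_frameLevel {β : ℝ} (hβ : 0 < β) (μ : ℝ) (K : TrigPolyC4v) (Λ : ℝ) (i : MatsubaraIdx M)
    (kv : TorusSite 2 L) (σ : Fin 2) :
    uvSymbolCT L M β μ K Λ ((i, kv), σ) =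
      uvSymbol₂ (β * (L : ℝ) ^ 2) Λ (fbPt (matsubaraFreq β M i) (frameLevel μ K (WithLp.toLp 2 (latticeMomentum L kv)))) := by
  rw [uvSymbolCT_eq_uvSymbolFn hβ, uvSymbol₂_apply_eq_uvSymbolFn, fbPt_apply_one, fbPt_apply_zero, nambuXiCT_eq_frameLevel]

omit [NeZero L] in
/-- Periodicity of a frame band on the momentum plane. -/
theorem frameLevel_toLp_periodic (μ : ℝ) (K : TrigPolyC4v) (p : Fin 2 → ℝ) (z : Fin 2 → ℤ) :
    frameLevel μ K (WithLp.toLp 2 (fun i => p i + z i * (2 * Real.pi))) = frameLevel μ K (WithLp.toLp 2 p) := by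
  rw [frameLevel_toLp_eq_ctBandFn, frameLevel_toLp_eq_ctBandFn, ctBandFn_periodic]

omit [NeZero L] in
/-- `(L/4)^k·(2π/L)^k = (π/2)^k`. -/
theorem quarter_mul_step_pow (hL : (0 : ℝ) < L) (k : ℕ) : ((L : ℝ) / 4) ^ k * (2 * Real.pi / L) ^ k = (Real.pi / 2) ^ k := by
  rw [← mul_pow]
  congr 1
  field_simp
  ring

/-! ## §2 The moments of the frame-shift symbol difference -/

/-- **THE (S)-HALF SUPPLIER OF DOOR (B)**: position moments of order `r` of the frame-shift symbol difference at the reading frequency `ω_i`,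
from the jets of the two frame bands.  With `m = max(|ω_i|, Λ/2)`, `A = 2βL²B(2/m)²`: if the interpolated bands `e_{K₀} + s(e_{K₁} − e_{K₀})` have
`‖Dⁱ‖ ≤ d·(6/m)^{i−1}` (`1 ≤ i ≤ r+2`, `s ∈ [0,1]`), the band difference has `‖Dⁱ(e_{K₁} − e_{K₀})‖ ≤ Wᵢ` (`i ≤ r+2`), the cutoff derivatives are `≤ B`
up to order `N ≥ r + 4`, and `(π/2)^k·Σ_{j≤k} C(k,j)·(j!·(A·j!)·(max(d,1)·6/m)ʲ)·W_{k−j} ≤ 𝒥` for every `k ≤ r+2`, then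
`Σ_x (1+|x̃₀|+|x̃₁|)^r·‖𝔉⁻¹[k⃗ ↦ Ψ_{K₁}((ω_i,k⃗),σ) − Ψ_{K₀}((ω_i,k⃗),σ)](x)‖ ≤ 21·3^r·𝒥`. -/
theorem frameShift_symbol_moment_le {β : ℝ} (hβ : 0 < β) {Λ : ℝ} (hΛ : 0 < Λ) {N : ℕ} {B : ℝ} (hB1 : 1 ≤ B)
    (hB : ∀ i ≤ N, ∀ t, ‖iteratedDeriv i salmhoferCutoff t‖ ≤ B) (r : ℕ) (hN : r + 4 ≤ N) (μ : ℝ) (K₀ K₁ : TrigPolyC4v)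
    (i : MatsubaraIdx M) (σ : Fin 2) {d : ℝ}
    (hD : ∀ s ∈ Icc (0 : ℝ) 1, ∀ j, 1 ≤ j → j ≤ r + 2 → ∀ q : EuclideanSpace ℝ (Fin 2),
      ‖iteratedFDeriv ℝ j (fun q => frameLevel μ K₀ q + s * (frameLevel μ K₁ q - frameLevel μ K₀ q)) q‖ ≤
        d * (6 / max |matsubaraFreq β M i| (Λ / 2)) ^ (j - 1))
    {W : ℕ → ℝ} (hW : ∀ j ≤ r + 2, ∀ q : EuclideanSpace ℝ (Fin 2), ‖iteratedFDeriv ℝ j (fun q => frameLevel μ K₁ q - frameLevel μ K₀ q) q‖ ≤ W j)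
    {J : ℝ}
    (hJ : ∀ k ≤ r + 2, (Real.pi / 2) ^ k * ∑ j ∈ Finset.range (k + 1), (k.choose j : ℝ) *
      (j ! * ((2 * (β * (L : ℝ) ^ 2) * B * (2 / max |matsubaraFreq β M i| (Λ / 2)) ^ 2) * j !) *
        (max d 1 * (6 / max |matsubaraFreq β M i| (Λ / 2))) ^ j) * W (k - j) ≤ J) :
    ∑ x : TorusSite 2 L, (1 + ((x 0).valMinAbs.natAbs : ℝ) + ((x 1).valMinAbs.natAbs : ℝ)) ^ r *
        ‖torusFourierInv (fun kv : TorusSite 2 L => uvSymbolCT L M β μ K₁ Λ ((i, kv), σ) - uvSymbolCT L M β μ K₀ Λ ((i, kv), σ)) x‖ ≤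
      21 * 3 ^ r * J := by
  have hL : (0 : ℝ) < L := Nat.cast_pos.2 (Nat.pos_of_ne_zero (NeZero.ne L))
  have hc : 0 ≤ β * (L : ℝ) ^ 2 := by positivity
  set ω : ℝ := matsubaraFreq β M i with hω
  set c : ℝ := β * (L : ℝ) ^ 2 with hcdef
  -- the two bands on the plane
  set vt : EuclideanSpace ℝ (Fin 2) → ℝ := fun q => frameLevel μ K₀ q with hvt
  set wt : EuclideanSpace ℝ (Fin 2) → ℝ := fun q => frameLevel μ K₁ q - frameLevel μ K₀ q with hwt
  have hvtc : ∀ {n : WithTop ℕ∞}, ContDiff ℝ n vt := fun {n} => contDiff_frameLevel μ K₀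
  have hwtc : ∀ {n : WithTop ℕ∞}, ContDiff ℝ n wt := fun {n} => (contDiff_frameLevel μ K₁).sub (contDiff_frameLevel μ K₀)
  have hperv : ∀ (p : Fin 2 → ℝ) (z : Fin 2 → ℤ), vt (WithLp.toLp 2 (fun i => p i + z i * (2 * Real.pi))) = vt (WithLp.toLp 2 p) :=
    fun p z => by simp only [hvt, frameLevel_toLp_periodic]
  have hperw : ∀ (p : Fin 2 → ℝ) (z : Fin 2 → ℤ), wt (WithLp.toLp 2 (fun i => p i + z i * (2 * Real.pi))) = wt (WithLp.toLp 2 p) :=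
    fun p z => by simp only [hwt, frameLevel_toLp_periodic]
  -- the two symbols as sampled compositions
  have hF₁ : (fun kv : TorusSite 2 L => uvSymbolCT L M β μ K₁ Λ ((i, kv), σ)) =
      fun y => uvSymbol₂ c Λ (fbPt ω (vt (WithLp.toLp 2 (latticeMomentum L y)) + wt (WithLp.toLp 2 (latticeMomentum L y)))) := by
    funext y
    rw [uvSymbolCT_eq_uvSymbol₂_frameLevel hβ]
    simp only [hvt, hwt, hω, hcdef, add_sub_cancel]
  have hF₀ : (fun kv : TorusSite 2 L => uvSymbolCT L M β μ K₀ Λ ((i, kv), σ)) =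
      fun y => uvSymbol₂ c Λ (fbPt ω (vt (WithLp.toLp 2 (latticeMomentum L y)))) := by
    funext y
    rw [uvSymbolCT_eq_uvSymbol₂_frameLevel hβ]
  -- the sup laws of every mixed difference of total order `≤ r + 2`
  refine sum_momentWeight_mul_norm_torusFourierInv_le r _ (fun a b hab k => ?_)
  rw [fwdDiff_iter₂_sub_apply, hF₁, hF₀]
  have hincr := incrPiece_value_le_of_geometric (L := L) hc hΛ hB1 hB (a := b) (b := a) (by omega) (hvtc) (hwtc) hperv hperw ω
    (d := d) (fun s hs j hj1 hj2 x => hD s hs j hj1 (by omega) x) (W := W) (fun j hj x => hW j (by omega) x) 1 0 k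
  rw [show b + a = a + b from Nat.add_comm b a] at hincr
  have hpos : 0 ≤ ((L : ℝ) / 4) ^ (a + b) := by positivity
  calc ((L : ℝ) / 4) ^ (a + b) * ‖(_root_.fwdDiff (Pi.single 1 (1 : ZMod L) : TorusSite 2 L))^[b]
          ((_root_.fwdDiff (Pi.single 0 (1 : ZMod L) : TorusSite 2 L))^[a]
            (fun y => uvSymbol₂ c Λ (fbPt ω (vt (WithLp.toLp 2 (latticeMomentum L y)) + wt (WithLp.toLp 2 (latticeMomentum L y)))))) k -
        (_root_.fwdDiff (Pi.single 1 (1 : ZMod L) : TorusSite 2 L))^[b]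
          ((_root_.fwdDiff (Pi.single 0 (1 : ZMod L) : TorusSite 2 L))^[a]
            (fun y => uvSymbol₂ c Λ (fbPt ω (vt (WithLp.toLp 2 (latticeMomentum L y)))))) k‖
      ≤ ((L : ℝ) / 4) ^ (a + b) * ((2 * Real.pi / L) ^ (a + b) *
          ∑ j ∈ Finset.range (a + b + 1), ((a + b).choose j : ℝ) *
            (j ! * ((2 * c * B * (2 / max |ω| (Λ / 2)) ^ 2) * j !) * (max d 1 * (6 / max |ω| (Λ / 2))) ^ j) * W (a + b - j)) :=
        mul_le_mul_of_nonneg_left hincr hpos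
    _ = (Real.pi / 2) ^ (a + b) * ∑ j ∈ Finset.range (a + b + 1), ((a + b).choose j : ℝ) *
            (j ! * ((2 * c * B * (2 / max |ω| (Λ / 2)) ^ 2) * j !) * (max d 1 * (6 / max |ω| (Λ / 2))) ^ j) * W (a + b - j) := by
        rw [← mul_assoc, quarter_mul_step_pow hL]
    _ ≤ J := by
        have h := hJ (a + b) hab
        simpa only [hcdef, hω, mul_assoc] using h

end Summit.HubbardSuperconductivity.HubbardSuperconductivity.Theorems.EngineV8

end
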